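import Mathlib.GroupTheory.FreeGroup.Reduce
import Mathlib.Data.Nat.Periodic
import Mathlib.Tactic.IntervalCases
import Mathlib.Tactic.Ring
import HarnessLib

/-!
# Rigidity of a cyclically Nielsen-reduced binary product with the value of a surface relator

Topic `Literature/GroupTheory/CombinatorialGroupTheory`.  The combinatorial core of
Zieschang's theorem on binary products with the value of the surface relator (H. Zieschang,
*Alternierende Produkte in freien Gruppen* (1964); Zieschang–Vogt–Coldewey, *Surfaces and Planar
Discontinuous Groups*, LNM 835 (1980), Thm. 5.2.8, orientable closed case: *"… only 5.2.9 is
possible … X₁X₂X₁⁻¹X₂⁻¹ = K[Tᵢ,Uᵢ]K⁻¹ … we again obtain n″ = n and the theorem follows"*), in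
the cyclic form needed for Cor. 5.2.13.

**Setting** (`SpikeConfig`).  After Zieschang's Nielsen reduction (`QuadraticWordsReduction`)
of the binary product `{Φ(aᵢ), Φ(bᵢ); ∏ [aᵢ, bᵢ]}` and the kernel decomposition of the
cyclically reduced product, one is left with the following data on the cyclic index set
`ℤ/4g` (realised on `ℕ` with period `4g`): the letters `ρ k` of the cyclic word
`r = a₀ b₀ a₀⁻¹ b₀⁻¹ a₁ ⋯` (injective on a period, and `ρ (blockStar k) = (ρ k)⁻¹` for the
block involution `blockStar` exchanging the positions of `aᵢ^{±1}` and of `bᵢ^{±1}` inside each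
block of four), the *spikes* `A k` (the part of the `k`-th value cancelled against the
`(k-1)`-st), so that the `k`-th value is the reduced word `A k · ρ k · (A (k+1))⁻¹`, a
*pairing* `s` with value `s k` formally inverse to value `k` (the two letters of a symbol of the
quadratic word), and the Nielsen inequalities `|A k| ≤ |A (k+1)| + 1`, `|A (k+1)| ≤ |A k| + 1`.

**Theorem** (`SpikeConfig.A_eq_nil`): if every letter is some `ρ k`, all spikes are empty —
every value is a single letter of `r`.  Proof: comparing the two reduced spellings of a paired
value classifies each pair as *even* (`A (s k) = A (k+1)`, `ρ (s k) = (ρ k)⁻¹`), *up* or *down*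
(`SpikeConfig.trichotomy`); an even pair inside a block forces the side between its two members
to be flat, whence even pairs are flat and a block is flat as soon as one of its sides is
(`SpikeConfig.block_flat`); along a flat block the spikes are constant; a highest spike followed
by a drop is the start of an *up* pair, and walking back block by block to the *down* pair by
which the plateau was entered produces an up- and a down-pair in one block with a flat side
between them — impossible; so all sides are flat, all spikes are equal, and a common nonempty
spike would end with a letter `ρ p` cancelling in the `p`-th value.

## References

* H. Zieschang, *Alternierende Produkte in freien Gruppen*, Abh. Math. Sem. Univ. Hamburg 27
  (1964) 13–31. [Zieschang1964]
* H. Zieschang, E. Vogt, H.-D. Coldewey, *Surfaces and Planar Discontinuous Groups*, LNM 835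
  (1980), §5.2, Thm. 5.2.8 (5.2.9–5.2.12), Cor. 5.2.13. [ZieschangVogtColdewey1980]
-/

namespace Literature.GroupTheory.CombinatorialGroupTheory

open List

/-! ### The block involution -/

/-- **The block involution** of the positions of the cyclic word `a₀b₀a₀⁻¹b₀⁻¹a₁b₁a₁⁻¹b₁⁻¹⋯`:
inside each block `4q, 4q+1, 4q+2, 4q+3` it exchanges `4q ↔ 4q+2` and `4q+1 ↔ 4q+3`, the
positions of mutually inverse letters. [cite: ZieschangVogtColdewey1980, 5.2.8 (proof)] -/
def blockStar (k : ℕ) : ℕ := 4 * (k / 4) + (k % 4 + 2) % 4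

/-- `blockStar` is an involution. [folklore] -/
theorem blockStar_blockStar (k : ℕ) : blockStar (blockStar k) = k := by
  unfold blockStar; omega

/-- `blockStar` commutes with shifts by whole blocks. [folklore] -/
theorem blockStar_add_four_mul (k n : ℕ) : blockStar (k + 4 * n) = blockStar k + 4 * n := by
  unfold blockStar; omega

/-- `blockStar` stays in the block. [folklore] -/
theorem blockStar_div_four (k : ℕ) : blockStar k / 4 = k / 4 := by
  unfold blockStar; omega

/-- `blockStar` on the first position of a block. [folklore] -/
theorem blockStar_of_mod_four_eq_zero {k : ℕ} (h : k % 4 = 0) : blockStar k = k + 2 := by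
  unfold blockStar; omega

/-- `blockStar` on the second position of a block. [folklore] -/
theorem blockStar_of_mod_four_eq_one {k : ℕ} (h : k % 4 = 1) : blockStar k = k + 2 := by
  unfold blockStar; omega

/-- `blockStar` on the third position of a block. [folklore] -/
theorem blockStar_of_mod_four_eq_two {k : ℕ} (h : k % 4 = 2) : blockStar k + 2 = k := by
  unfold blockStar; omega

/-- `blockStar` on the fourth position of a block. [folklore] -/
theorem blockStar_of_mod_four_eq_three {k : ℕ} (h : k % 4 = 3) : blockStar k + 2 = k := by
  unfold blockStar; omega

/-- `blockStar` respects congruence modulo a multiple of four. [folklore] -/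
theorem blockStar_mod_congr {g a b : ℕ} (h : a % (4 * g) = b % (4 * g)) :
    blockStar a % (4 * g) = blockStar b % (4 * g) := by
  have ha := Nat.mod_add_div a (4 * g)
  have hb := Nat.mod_add_div b (4 * g)
  rw [← ha, ← hb, h, show 4 * g * (a / (4 * g)) = 4 * (g * (a / (4 * g))) by ring,
    show 4 * g * (b / (4 * g)) = 4 * (g * (b / (4 * g))) by ring,
    blockStar_add_four_mul, blockStar_add_four_mul,
    show 4 * (g * (a / (4 * g))) = 4 * g * (a / (4 * g)) by ring,
    show 4 * (g * (b / (4 * g))) = 4 * g * (b / (4 * g)) by ring,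
    Nat.add_mul_mod_self_left, Nat.add_mul_mod_self_left]

/-! ### A word lemma: the two spellings of a paired value -/

section Words

variable {β : Type*}

/-- A cancelling pair of letters is not a reduced word. [folklore] -/
theorem not_isReduced_append_cons_cons_inv (X Y : List (β × Bool)) (x : β × Bool) :
    ¬ FreeGroup.IsReduced (X ++ x :: (x.1, !x.2) :: Y) := by
  intro h
  have h2 : FreeGroup.IsReduced [x, (x.1, !x.2)] := h.infix ⟨X, Y, by simp⟩
  have := (FreeGroup.isReduced_cons_cons.1 h2).1 rfl
  cases x.2 <;> simp at this

/-- `invRev` of a snoc. [folklore] -/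
theorem invRev_append_singleton (L : List (β × Bool)) (x : β × Bool) :
    FreeGroup.invRev (L ++ [x]) = (x.1, !x.2) :: FreeGroup.invRev L := by
  rw [FreeGroup.invRev_append]; rfl

/-- `invRev` of a cons, in snoc form. [folklore] -/
theorem invRev_cons_eq (L : List (β × Bool)) (x : β × Bool) :
    FreeGroup.invRev (x :: L) = FreeGroup.invRev L ++ [(x.1, !x.2)] := by
  rw [FreeGroup.invRev_cons]; rfl

/-- **The two spellings of a paired value.**  If the reduced word `C · y · D⁻¹` is the formal
inverse of `A · x · B⁻¹`, i.e. equals `B · x⁻¹ · A⁻¹`, and the four spikes satisfy the Nielsen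
inequalities `|A| ≤ |B| + 1`, `|B| ≤ |A| + 1`, `|C| ≤ |D| + 1`, `|D| ≤ |C| + 1`, then the pair
is *even* (`C = B`, `y = x⁻¹`, `D = A`), *up* (`C = B x⁻¹`, `A = D y⁻¹`) or *down* (`B = C y`,
`D = A x`). [cite: ZieschangVogtColdewey1980, 5.2.8 (proof)] -/
theorem spellings_trichotomy {A B C D : List (β × Bool)} {x y : β × Bool}
    (h : C ++ y :: FreeGroup.invRev D = B ++ (x.1, !x.2) :: FreeGroup.invRev A)
    (hAB : A.length ≤ B.length + 1) (hBA : B.length ≤ A.length + 1)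
    (hCD : C.length ≤ D.length + 1) (hDC : D.length ≤ C.length + 1) :
    (C = B ∧ y = (x.1, !x.2) ∧ D = A) ∨
    (C = B ++ [(x.1, !x.2)] ∧ A = D ++ [(y.1, !y.2)]) ∨
    (B = C ++ [y] ∧ D = A ++ [x]) := by
  rcases append_eq_append_iff.1 h with ⟨a', hB, hy⟩ | ⟨c', hC, hx⟩
  · -- `B = C ++ a'`
    cases a' with
    | nil =>
      rw [append_nil] at hB
      rw [nil_append] at hy
      obtain ⟨rfl, hD⟩ := List.cons.inj hy
      exact Or.inl ⟨hB.symm, rfl, FreeGroup.invRev_injective hD⟩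
    | cons z a'' =>
      rw [cons_append] at hy
      obtain ⟨rfl, hD⟩ := List.cons.inj hy
      -- lengths force `a'' = []`
      have h1 := congrArg length hD
      have h2 := congrArg length hB
      simp only [FreeGroup.invRev_length, length_append, length_cons] at h1 h2
      have ha : a'' = [] := length_eq_zero_iff.1 (by omega)
      subst ha
      refine Or.inr (Or.inr ⟨hB, ?_⟩)
      rw [nil_append] at hD
      apply FreeGroup.invRev_injective
      rw [hD, invRev_append_singleton]
  · -- `C = B ++ c'`
    cases c' with
    | nil =>
      rw [append_nil] at hC
      rw [nil_append] at hx
      obtain ⟨rfl, hD⟩ := List.cons.inj hx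
      exact Or.inl ⟨hC, rfl, FreeGroup.invRev_injective hD.symm⟩
    | cons z c'' =>
      rw [cons_append] at hx
      obtain ⟨rfl, hA⟩ := List.cons.inj hx
      have h1 := congrArg length hA
      have h2 := congrArg length hC
      simp only [FreeGroup.invRev_length, length_append, length_cons] at h1 h2
      have hc : c'' = [] := length_eq_zero_iff.1 (by omega)
      subst hc
      refine Or.inr (Or.inl ⟨hC, ?_⟩)
      rw [nil_append] at hA
      apply FreeGroup.invRev_injective
      rw [hA, invRev_append_singleton, Bool.not_not]

end Words

/-! ### Spike configurations -/

/-- **Spike configuration**: the data left by Zieschang's reduction of a binary product with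
the value of the surface relator — the letters `ρ` of the cyclic relator (period `4g`,
injective on a period, inverse letters at `blockStar`-related positions), the spikes `A k`
(period `4g`) such that the `k`-th value is the reduced word `A k · ρ k · (A (k+1))⁻¹`, a
pairing `s` of the indices with formally inverse values, and the Nielsen inequalities between
consecutive spikes. [cite: ZieschangVogtColdewey1980, 5.2.8 (proof)] -/
structure SpikeConfig (β : Type*) where
  /-- the genus -/
  g : ℕ
  /-- the letters of the cyclic relator -/
  ρ : ℕ → β × Bool
  /-- the spikes -/
  A : ℕ → List (β × Bool)
  /-- the pairing -/
  s : ℕ → ℕ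
  g_pos : 0 < g
  ρ_periodic : Function.Periodic ρ (4 * g)
  ρ_inj : ∀ k l, ρ k = ρ l → k % (4 * g) = l % (4 * g)
  ρ_blockStar : ∀ k, ρ (blockStar k) = ((ρ k).1, !(ρ k).2)
  A_periodic : Function.Periodic A (4 * g)
  isReduced : ∀ k, FreeGroup.IsReduced (A k ++ ρ k :: FreeGroup.invRev (A (k + 1)))
  pair : ∀ k, A (s k) ++ ρ (s k) :: FreeGroup.invRev (A (s k + 1)) =
    FreeGroup.invRev (A k ++ ρ k :: FreeGroup.invRev (A (k + 1)))
  length_le_succ : ∀ k, (A k).length ≤ (A (k + 1)).length + 1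
  length_succ_le : ∀ k, (A (k + 1)).length ≤ (A k).length + 1

namespace SpikeConfig

variable {β : Type*} (C : SpikeConfig β)

/-- The length of the `k`-th spike. [folklore] -/
def α (k : ℕ) : ℕ := (C.A k).length

/-- The spike lengths are periodic. [folklore] -/
theorem α_periodic : Function.Periodic C.α (4 * C.g) := fun k => by
  simp only [α, C.A_periodic k]

/-- Spikes at congruent indices agree. [folklore] -/
theorem A_congr {a b : ℕ} (h : a % (4 * C.g) = b % (4 * C.g)) : C.A a = C.A b := by
  rw [← C.A_periodic.map_mod_nat a, h, C.A_periodic.map_mod_nat]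

/-- Spike lengths at congruent indices agree. [folklore] -/
theorem α_congr {a b : ℕ} (h : a % (4 * C.g) = b % (4 * C.g)) : C.α a = C.α b := by
  simp only [α, C.A_congr h]

/-- Letters at congruent indices agree. [folklore] -/
theorem ρ_congr {a b : ℕ} (h : a % (4 * C.g) = b % (4 * C.g)) : C.ρ a = C.ρ b := by
  rw [← C.ρ_periodic.map_mod_nat a, h, C.ρ_periodic.map_mod_nat]

/-- Successors of congruent indices are congruent. [folklore] -/
theorem succ_mod_congr {a b : ℕ} (h : a % (4 * C.g) = b % (4 * C.g)) :
    (a + 1) % (4 * C.g) = (b + 1) % (4 * C.g) := by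
  rw [Nat.add_mod, h, ← Nat.add_mod]

/-! ### The three kinds of pairs -/

/-- **Even pair**: `A (s k) = A (k+1)`, `ρ (s k) = (ρ k)⁻¹`, `A (s k + 1) = A k`. [folklore] -/
def IsEven (k : ℕ) : Prop :=
  C.A (C.s k) = C.A (k + 1) ∧ C.ρ (C.s k) = ((C.ρ k).1, !(C.ρ k).2) ∧ C.A (C.s k + 1) = C.A k

/-- **Up pair**: the spikes at the starts of the two paired sides are one letter longer than
those at their ends, and end with the inverse kernel letters. [folklore] -/
def IsUp (k : ℕ) : Prop :=
  C.A (C.s k) = C.A (k + 1) ++ [((C.ρ k).1, !(C.ρ k).2)] ∧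
    C.A k = C.A (C.s k + 1) ++ [((C.ρ (C.s k)).1, !(C.ρ (C.s k)).2)]

/-- **Down pair**: the spikes at the ends of the two paired sides are one letter longer and end
with the kernel letters. [folklore] -/
def IsDown (k : ℕ) : Prop :=
  C.A (k + 1) = C.A (C.s k) ++ [C.ρ (C.s k)] ∧ C.A (C.s k + 1) = C.A k ++ [C.ρ k]

/-- **Every pair is even, up or down.** [cite: ZieschangVogtColdewey1980, 5.2.8 (proof)] -/
theorem trichotomy (k : ℕ) : C.IsEven k ∨ C.IsUp k ∨ C.IsDown k := by
  have h := C.pair k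
  rw [FreeGroup.invRev_append, invRev_cons_eq, FreeGroup.invRev_invRev, append_assoc,
    singleton_append] at h
  rcases spellings_trichotomy h (C.length_le_succ k) (C.length_succ_le k)
      (C.length_le_succ (C.s k)) (C.length_succ_le (C.s k)) with
    ⟨h1, h2, h3⟩ | ⟨h1, h2⟩ | ⟨h1, h2⟩
  · exact Or.inl ⟨h1, h2, h3⟩
  · exact Or.inr (Or.inl ⟨h1, h2⟩)
  · exact Or.inr (Or.inr ⟨h1, h2⟩)

/-- In an even pair the partner index is congruent to the `blockStar`. [folklore] -/
theorem IsEven.s_mod {k : ℕ} (h : C.IsEven k) : C.s k % (4 * C.g) = blockStar k % (4 * C.g) :=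
  C.ρ_inj _ _ (by rw [h.2.1, C.ρ_blockStar])

/-- In an even pair, the spike at the `blockStar` position is the spike at `k + 1`. [folklore] -/
theorem IsEven.A_blockStar {k : ℕ} (h : C.IsEven k) : C.A (blockStar k) = C.A (k + 1) := by
  rw [← C.A_congr h.s_mod]; exact h.1

/-- In an even pair, the spike after the `blockStar` position is the spike at `k`. [folklore] -/
theorem IsEven.A_blockStar_succ {k : ℕ} (h : C.IsEven k) : C.A (blockStar k + 1) = C.A k := by
  rw [← C.A_congr (C.succ_mod_congr h.s_mod)]; exact h.2.2

/-- Spike lengths in an even pair. [folklore] -/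
theorem IsEven.α_blockStar {k : ℕ} (h : C.IsEven k) : C.α (blockStar k) = C.α (k + 1) := by
  simp only [α, h.A_blockStar]

/-- Spike lengths in an even pair. [folklore] -/
theorem IsEven.α_blockStar_succ {k : ℕ} (h : C.IsEven k) : C.α (blockStar k + 1) = C.α k := by
  simp only [α, h.A_blockStar_succ]

/-- Spike lengths in an up pair: the side drops by one. [folklore] -/
theorem IsUp.α_eq {k : ℕ} (h : C.IsUp k) : C.α k = C.α (k + 1) + 1 ∧ C.α (C.s k) = C.α (k + 1) + 1 ∧
    C.α k = C.α (C.s k + 1) + 1 := by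
  obtain ⟨ha, hb⟩ := h
  have h1 := congrArg length ha
  have h2 := congrArg length hb
  rw [length_append, length_singleton] at h1 h2
  have h3 := C.length_le_succ k
  have h4 := C.length_le_succ (C.s k)
  unfold α
  omega

/-- Spike lengths in a down pair: the side rises by one. [folklore] -/
theorem IsDown.α_eq {k : ℕ} (h : C.IsDown k) : C.α (k + 1) = C.α k + 1 ∧
    C.α (k + 1) = C.α (C.s k) + 1 ∧ C.α (C.s k + 1) = C.α k + 1 := by
  obtain ⟨ha, hb⟩ := h
  have h1 := congrArg length ha
  have h2 := congrArg length hb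
  rw [length_append, length_singleton] at h1 h2
  have h3 := C.length_succ_le k
  have h4 := C.length_succ_le (C.s k)
  unfold α
  omega

/-- **A flat side belongs to an even pair.** [folklore] -/
theorem isEven_of_flat {k : ℕ} (hf : C.α (k + 1) = C.α k) : C.IsEven k := by
  rcases C.trichotomy k with h | h | h
  · exact h
  · have := h.α_eq.1; omega
  · have := h.α_eq.1; omega

/-- **Even pairs are flat**: if the pair of the side `k` is even then `|A (k+1)| = |A k|`
(the side strictly between the two members of the pair, inside their block, is flat, hence
even, and its own evenness closes the cycle of lengths). [cite: ZieschangVogtColdewey1980, 5.2.8 (proof)] -/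
theorem IsEven.flat {k : ℕ} (h : C.IsEven k) : C.α (k + 1) = C.α k := by
  have h1 := h.α_blockStar
  have h2 := h.α_blockStar_succ
  have hk : k % 4 = 0 ∨ k % 4 = 1 ∨ k % 4 = 2 ∨ k % 4 = 3 := by omega
  rcases hk with hk | hk | hk | hk
  · rw [blockStar_of_mod_four_eq_zero hk] at h1 h2
    -- the side `k + 1` is flat, hence even, with `blockStar (k+1) = k + 3`
    have h3 := (C.isEven_of_flat h1).α_blockStar
    rw [blockStar_of_mod_four_eq_one (by omega)] at h3
    simp only [Nat.add_assoc, Nat.reduceAdd] at *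
    omega
  · rw [blockStar_of_mod_four_eq_one hk] at h1 h2
    have h3 := (C.isEven_of_flat h1).α_blockStar_succ
    have e : blockStar (k + 1) + 2 = k + 1 := blockStar_of_mod_four_eq_two (by omega)
    rw [show blockStar (k + 1) + 1 = k by omega] at h3
    omega
  · obtain ⟨j, rfl⟩ : ∃ j, k = j + 2 := ⟨k - 2, by omega⟩
    have e : blockStar (j + 2) = j := by
      have := blockStar_of_mod_four_eq_two hk; omega
    rw [e] at h1 h2
    -- the side `j + 1` is flat
    have h3 := (C.isEven_of_flat (k := j + 1) (by simpa using h2.symm)).α_blockStar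
    rw [blockStar_of_mod_four_eq_one (by omega)] at h3
    omega
  · obtain ⟨j, rfl⟩ : ∃ j, k = j + 3 := ⟨k - 3, by omega⟩
    have e : blockStar (j + 3) = j + 1 := by
      have := blockStar_of_mod_four_eq_three hk; omega
    rw [e] at h1 h2
    -- the side `j + 2` is flat, and `blockStar (j + 2) = j`
    have h4 := C.isEven_of_flat (k := j + 2) (by simpa using h2.symm)
    have h5 := h4.α_blockStar
    have h6 := h4.α_blockStar_succ
    have e' : blockStar (j + 2) = j := by
      have := blockStar_of_mod_four_eq_two (k := j + 2) (by omega); omega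
    rw [e'] at h5 h6
    simp only [Nat.add_assoc, Nat.reduceAdd] at *
    omega

/-- A rising side belongs to a down pair. [folklore] -/
theorem isDown_of_rise {k : ℕ} (hf : C.α (k + 1) = C.α k + 1) : C.IsDown k := by
  rcases C.trichotomy k with h | h | h
  · have := h.flat; omega
  · have := h.α_eq.1; omega
  · exact h

/-- A dropping side belongs to an up pair. [folklore] -/
theorem isUp_of_drop {k : ℕ} (hf : C.α k = C.α (k + 1) + 1) : C.IsUp k := by
  rcases C.trichotomy k with h | h | h
  · have := h.flat; omega
  · exact h
  · have := h.α_eq.1; omega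

/-! ### Flat blocks -/

/-- If the second side of a block is flat, the whole block is flat. [folklore] -/
theorem block_flat_of_flat_one {b : ℕ} (hb : b % 4 = 0) (hf : C.α (b + 2) = C.α (b + 1)) :
    C.α (b + 1) = C.α b ∧ C.α (b + 3) = C.α (b + 2) ∧ C.α (b + 4) = C.α (b + 3) := by
  have h1 := C.isEven_of_flat (k := b + 1) hf
  have h2 := h1.α_blockStar
  have h3 := h1.α_blockStar_succ
  rw [blockStar_of_mod_four_eq_one (by omega)] at h2 h3
  -- now the side `b + 2` is flat
  have h4 := C.isEven_of_flat (k := b + 2) (by omega)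
  have h5 := h4.α_blockStar
  have h6 := h4.α_blockStar_succ
  have e : blockStar (b + 2) = b := by
    have := blockStar_of_mod_four_eq_two (k := b + 2) (by omega); omega
  rw [e] at h5 h6
  simp only [Nat.add_assoc, Nat.reduceAdd] at *
  omega

/-- **A block is flat as soon as one of its sides is**: for `b ≡ 0 (mod 4)` and `r < 4`, if the
side `b + r` is flat then all four sides `b, …, b + 3` are. [cite: ZieschangVogtColdewey1980, 5.2.8 (proof)] -/
theorem block_flat {b r : ℕ} (hb : b % 4 = 0) (hr : r < 4) (hf : C.α (b + r + 1) = C.α (b + r)) :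
    C.α (b + 1) = C.α b ∧ C.α (b + 2) = C.α (b + 1) ∧ C.α (b + 3) = C.α (b + 2) ∧
      C.α (b + 4) = C.α (b + 3) := by
  have key : C.α (b + 2) = C.α (b + 1) := by
    interval_cases r
    · have h1 := (C.isEven_of_flat (k := b) hf).α_blockStar
      rw [blockStar_of_mod_four_eq_zero hb] at h1
      exact h1
    · exact hf
    · have h1 := C.isEven_of_flat (k := b + 2) hf
      have h2 := h1.α_blockStar_succ
      have e : blockStar (b + 2) = b := by
        have := blockStar_of_mod_four_eq_two (k := b + 2) (by omega); omega
      rw [e] at h2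
      simp only [Nat.add_assoc, Nat.reduceAdd] at *
      omega
    · have h1 := C.isEven_of_flat (k := b + 3) hf
      have h2 := h1.α_blockStar_succ
      have h3 := h1.α_blockStar
      have e : blockStar (b + 3) = b + 1 := by
        have := blockStar_of_mod_four_eq_three (k := b + 3) (by omega); omega
      rw [e] at h2 h3
      simp only [Nat.add_assoc, Nat.reduceAdd] at *
      omega
  obtain ⟨h1, h3, h4⟩ := C.block_flat_of_flat_one hb key
  exact ⟨h1, key, h3, h4⟩

/-- **Along a flat block the spikes are constant.** [folklore] -/
theorem block_A_const {b : ℕ} (hb : b % 4 = 0) (hf : C.α (b + 2) = C.α (b + 1)) :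
    C.A (b + 1) = C.A b ∧ C.A (b + 2) = C.A b ∧ C.A (b + 3) = C.A b ∧ C.A (b + 4) = C.A b := by
  obtain ⟨h0, h2, -⟩ := C.block_flat_of_flat_one hb hf
  have e0 := C.isEven_of_flat (k := b) h0
  have e1 := C.isEven_of_flat (k := b + 1) hf
  have a1 := e0.A_blockStar
  have a2 := e0.A_blockStar_succ
  have a3 := e1.A_blockStar
  have a4 := e1.A_blockStar_succ
  rw [blockStar_of_mod_four_eq_zero hb] at a1 a2
  rw [blockStar_of_mod_four_eq_one (by omega)] at a3 a4
  change C.A (b + 3) = C.A b at a2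
  change C.A (b + 3) = C.A (b + 2) at a3
  change C.A (b + 4) = C.A (b + 1) at a4
  have e1 : C.A (b + 1) = C.A b := by rw [← a1, ← a3]; exact a2
  exact ⟨e1, by rw [a1, e1], a2, by rw [a4, e1]⟩

/-- A flat side not ending a block is followed by a flat side. [folklore] -/
theorem flat_succ_of_flat {Q : ℕ} (hQ : (Q + 1) % 4 ≠ 0) (hf : C.α (Q + 1) = C.α Q) :
    C.α (Q + 2) = C.α (Q + 1) := by
  have hb : (4 * (Q / 4)) % 4 = 0 := by omega
  have hr : Q % 4 < 4 := Nat.mod_lt _ (by norm_num)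
  have e : 4 * (Q / 4) + Q % 4 = Q := Nat.div_add_mod Q 4
  obtain ⟨h1, h2, h3, -⟩ := C.block_flat hb hr (by rw [e]; exact hf)
  have hQ' : Q % 4 = 0 ∨ Q % 4 = 1 ∨ Q % 4 = 2 := by omega
  rcases hQ' with h | h | h
  · rw [h, add_zero] at e
    rw [e] at h1 h2; exact h2
  · rw [h] at e
    rw [show 4 * (Q / 4) + 2 = Q + 1 by omega, show 4 * (Q / 4) + 3 = Q + 2 by omega] at h3
    exact h3
  · rw [h] at e
    have h4 := (C.block_flat hb hr (by rw [Nat.div_add_mod]; exact hf)).2.2.2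
    rw [show 4 * (Q / 4) + 3 = Q + 1 by omega, show 4 * (Q / 4) + 4 = Q + 2 by omega] at h4
    exact h4

/-- **An up pair and a down pair cannot sit in one block**: no index `i` has a rising side
`i`, with `|A (blockStar i)| = |A (i+1)|` and `|A (blockStar i + 1)| = |A i|` (the side between
`i` and `blockStar i` would be flat, making the whole block flat).
[cite: ZieschangVogtColdewey1980, 5.2.8 (proof)] -/
theorem block_clash {i : ℕ} (h1 : C.α (i + 1) = C.α i + 1) (h2 : C.α (blockStar i) = C.α (i + 1))
    (h3 : C.α (blockStar i + 1) = C.α i) : False := by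
  have hi : i % 4 = 0 ∨ i % 4 = 1 ∨ i % 4 = 2 ∨ i % 4 = 3 := by omega
  rcases hi with hi | hi | hi | hi
  · rw [blockStar_of_mod_four_eq_zero hi] at h2 h3
    have := (C.block_flat (b := i) (r := 1) hi (by norm_num) h2).1
    omega
  · obtain ⟨b, rfl⟩ : ∃ b, i = b + 1 := ⟨i - 1, by omega⟩
    rw [blockStar_of_mod_four_eq_one hi] at h2 h3
    have := (C.block_flat (b := b) (r := 2) (by omega) (by norm_num) h2).2.1
    simp only [Nat.add_assoc, Nat.reduceAdd] at *
    omega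
  · obtain ⟨b, rfl⟩ : ∃ b, i = b + 2 := ⟨i - 2, by omega⟩
    have e : blockStar (b + 2) = b := by
      have := blockStar_of_mod_four_eq_two hi; omega
    rw [e] at h2 h3
    have := (C.block_flat (b := b) (r := 1) (by omega) (by norm_num) h3.symm).2.2.1
    simp only [Nat.add_assoc, Nat.reduceAdd] at *
    omega
  · obtain ⟨b, rfl⟩ : ∃ b, i = b + 3 := ⟨i - 3, by omega⟩
    have e : blockStar (b + 3) = b + 1 := by
      have := blockStar_of_mod_four_eq_three hi; omega
    rw [e] at h2 h3
    have := (C.block_flat (b := b) (r := 2) (by omega) (by norm_num) h3.symm).2.2.2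
    simp only [Nat.add_assoc, Nat.reduceAdd] at *
    omega

/-! ### The highest spikes -/

/-- The spike lengths attain a maximum. [folklore] -/
theorem exists_max : ∃ M, (∀ k, C.α k ≤ M) ∧ ∃ q, C.α q = M := by
  have hne : (Finset.range (4 * C.g)).Nonempty := ⟨0, Finset.mem_range.2 (by have := C.g_pos; omega)⟩
  obtain ⟨q, -, hq⟩ := (Finset.range (4 * C.g)).exists_max_image C.α hne
  refine ⟨C.α q, fun k => ?_, q, rfl⟩
  rw [← C.α_periodic.map_mod_nat k]
  exact hq _ (Finset.mem_range.2 (Nat.mod_lt _ (by have := C.g_pos; omega)))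

/-- If some side is not flat, a highest spike is followed by a drop. [folklore] -/
theorem exists_drop {M q₀ : ℕ} (hM : ∀ k, C.α k ≤ M) (hq₀ : C.α q₀ = M)
    (hnf : ∃ k, C.α (k + 1) ≠ C.α k) : ∃ q, C.α q = M ∧ C.α (q + 1) + 1 = M := by
  classical
  obtain ⟨k, hk⟩ := hnf
  -- a non-flat side of the form `q₀ + t`
  have hP : ∃ t, C.α (q₀ + t + 1) ≠ C.α (q₀ + t) := by
    have hper := C.α_periodic.nat_mul q₀
    simp only [Nat.cast_id] at hper
    refine ⟨k + q₀ * (4 * C.g) - q₀, ?_⟩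
    have h1 : q₀ ≤ k + q₀ * (4 * C.g) :=
      le_add_left (Nat.le_mul_of_pos_right _ (by have := C.g_pos; omega))
    rw [show q₀ + (k + q₀ * (4 * C.g) - q₀) = k + q₀ * (4 * C.g) by omega,
      show k + q₀ * (4 * C.g) + 1 = (k + 1) + q₀ * (4 * C.g) by ring, hper, hper]
    exact hk
  refine ⟨q₀ + Nat.find hP, ?_, ?_⟩
  · -- all sides before are flat
    have hflat : ∀ t, t ≤ Nat.find hP → C.α (q₀ + t) = M := by
      intro t ht
      induction t with
      | zero => simpa using hq₀
      | succ t ih =>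
        have h := Nat.find_min hP (show t < Nat.find hP by omega)
        rw [not_not] at h
        rw [← add_assoc, h, ih (by omega)]
    exact hflat _ le_rfl
  · have hflat : ∀ t, t ≤ Nat.find hP → C.α (q₀ + t) = M := by
      intro t ht
      induction t with
      | zero => simpa using hq₀
      | succ t ih =>
        have h := Nat.find_min hP (show t < Nat.find hP by omega)
        rw [not_not] at h
        rw [← add_assoc, h, ih (by omega)]
    have h0 := hflat _ le_rfl
    have h1 := hM (q₀ + Nat.find hP + 1)
    have h2 : C.α (q₀ + Nat.find hP) ≤ C.α (q₀ + Nat.find hP + 1) + 1 := C.length_le_succ _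
    have h3 : C.α (q₀ + Nat.find hP + 1) ≠ C.α (q₀ + Nat.find hP) := Nat.find_spec hP
    omega

/-- **The clash**: a corner `Q + 1` carrying a highest spike of the up-form
`A (j+1) · (ρ j)⁻¹` (with `|A j| = M`, `|A (j+1)| = M - 1`) cannot be entered by a non-flat
side — that side would be a down pair whose partner is `blockStar j`, putting an up pair and a
down pair in one block. [cite: ZieschangVogtColdewey1980, 5.2.8 (proof)] -/
theorem clash_of_entry {M Q j : ℕ} (hM : ∀ k, C.α k ≤ M) (hαj : C.α j = M)
    (hαj1 : C.α (j + 1) + 1 = M) (hAQ : C.A (Q + 1) = C.A (j + 1) ++ [((C.ρ j).1, !(C.ρ j).2)])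
    (hnf : C.α (Q + 1) ≠ C.α Q) : False := by
  have hαQ1 : C.α (Q + 1) = M := by
    have := congrArg length hAQ
    rw [length_append, length_singleton] at this
    unfold α at *
    omega
  have hQ := hM Q
  have hlip : C.α (Q + 1) ≤ C.α Q + 1 := C.length_succ_le Q
  have hrise : C.α (Q + 1) = C.α Q + 1 := by omega
  obtain ⟨hD1, hD2⟩ := C.isDown_of_rise hrise
  obtain ⟨e1, e2, e3⟩ := (C.isDown_of_rise hrise).α_eq
  set i := C.s Q with hi
  -- the partner of the entering side is `blockStar j`
  rw [hAQ] at hD1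
  obtain ⟨-, hρ⟩ := append_inj' hD1 rfl
  have hρ' : C.ρ i = C.ρ (blockStar j) := by
    rw [C.ρ_blockStar]; exact (List.singleton_inj.1 hρ).symm
  have hmod : i % (4 * C.g) = blockStar j % (4 * C.g) := C.ρ_inj _ _ hρ'
  have hmod' : blockStar i % (4 * C.g) = j % (4 * C.g) := by
    rw [blockStar_mod_congr hmod, blockStar_blockStar]
  have h2 : C.α (blockStar i) = C.α j := C.α_congr hmod'
  have h3 : C.α (blockStar i + 1) = C.α (j + 1) := C.α_congr (C.succ_mod_congr hmod')
  exact C.block_clash (i := i) (by omega) (by omega) (by omega)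

/-- **No highest spike is followed by a drop.** Walking back from such a corner block by block
along flat blocks (where the spikes are constant) one reaches the non-flat side by which the
plateau was entered, and `clash_of_entry` applies. [cite: ZieschangVogtColdewey1980, 5.2.8 (proof)] -/
theorem no_drop {M q : ℕ} (hM : ∀ k, C.α k ≤ M) (hq : C.α q = M) (hq1 : C.α (q + 1) + 1 = M) :
    False := by
  obtain ⟨hU1, hU2⟩ := C.isUp_of_drop (k := q) (by omega)
  obtain ⟨u1, u2, u3⟩ := (C.isUp_of_drop (k := q) (by omega)).α_eq
  set j := C.s q with hj
  have hαj : C.α j = M := by omega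
  have hαj1 : C.α (j + 1) + 1 = M := by omega
  by_cases hq4 : q % 4 = 0
  · -- walk back along the blocks `q + 4u, …, q + 4u + 3`
    have key : ∀ u, u + 1 ≤ C.g →
        C.A (q + 4 * u + 4) = C.A (j + 1) ++ [((C.ρ j).1, !(C.ρ j).2)] → False := by
      intro u
      induction u with
      | zero =>
        intro _ hA
        by_cases hf : C.α (q + 3 + 1) = C.α (q + 3)
        · have := (C.block_flat (b := q) (r := 3) hq4 (by norm_num) hf).1
          omega
        · exact C.clash_of_entry hM hαj hαj1 (Q := q + 3) hA hf
      | succ u ih =>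
        intro hu hA
        by_cases hf : C.α (q + 4 * (u + 1) + 3 + 1) = C.α (q + 4 * (u + 1) + 3)
        · -- the block `q + 4(u+1), …` is flat: spikes constant along it
          have hb : (q + 4 * (u + 1)) % 4 = 0 := by omega
          have hflat := C.block_flat (b := q + 4 * (u + 1)) (r := 3) hb (by norm_num) hf
          have hconst := C.block_A_const hb hflat.2.1
          refine ih (by omega) ?_
          rw [show q + 4 * u + 4 = q + 4 * (u + 1) by ring, ← hconst.2.2.2,
            show q + 4 * (u + 1) + 4 = q + 4 * (u + 1) + 4 from rfl]
          exact hA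
        · exact C.clash_of_entry hM hαj hαj1 (Q := q + 4 * (u + 1) + 3) hA hf
    refine key (C.g - 1) (by have := C.g_pos; omega) ?_
    rw [show q + 4 * (C.g - 1) + 4 = q + 4 * C.g by have := C.g_pos; omega, C.A_periodic]
    exact hU2
  · -- the entering side is in the same, non-flat, block
    have hQ : (q + 4 * C.g - 1 + 1) % 4 ≠ 0 := by have := C.g_pos; omega
    refine C.clash_of_entry hM hαj hαj1 (Q := q + 4 * C.g - 1) ?_ ?_
    · rw [show q + 4 * C.g - 1 + 1 = q + 4 * C.g by have := C.g_pos; omega, C.A_periodic]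
      exact hU2
    · intro hf
      have h2 := C.flat_succ_of_flat hQ hf
      rw [show q + 4 * C.g - 1 + 2 = (q + 1) + 4 * C.g by have := C.g_pos; omega,
        show q + 4 * C.g - 1 + 1 = q + 4 * C.g by have := C.g_pos; omega,
        C.α_periodic, C.α_periodic] at h2
      omega

/-- **All sides are flat.** [cite: ZieschangVogtColdewey1980, 5.2.8 (proof)] -/
theorem flat_all (k : ℕ) : C.α (k + 1) = C.α k := by
  by_contra hk
  obtain ⟨M, hM, q₀, hq₀⟩ := C.exists_max
  obtain ⟨q, hq, hq1⟩ := C.exists_drop hM hq₀ ⟨k, hk⟩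
  exact C.no_drop hM hq hq1

/-- **All spikes are equal.** [cite: ZieschangVogtColdewey1980, 5.2.8 (proof)] -/
theorem A_eq_A_zero (k : ℕ) : C.A k = C.A 0 := by
  induction k using Nat.strong_induction_on with
  | _ k ih =>
    rcases Nat.eq_zero_or_pos k with rfl | hk
    · rfl
    by_cases h4 : k % 4 = 0
    · obtain ⟨b, rfl⟩ : ∃ b, k = b + 4 := ⟨k - 4, by omega⟩
      have hb : b % 4 = 0 := by omega
      rw [(C.block_A_const hb (C.flat_all (b + 1))).2.2.2]
      exact ih b (by omega)
    · have hb : (4 * (k / 4)) % 4 = 0 := by omega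
      have hc := C.block_A_const hb (C.flat_all (4 * (k / 4) + 1))
      have hr : k % 4 = 1 ∨ k % 4 = 2 ∨ k % 4 = 3 := by omega
      have e := Nat.div_add_mod k 4
      rcases hr with h | h | h
      · rw [h] at e
        rw [← e, hc.1]
        exact ih _ (by omega)
      · rw [h] at e
        rw [← e, hc.2.1]
        exact ih _ (by omega)
      · rw [h] at e
        rw [← e, hc.2.2.1]
        exact ih _ (by omega)

/-- **Rigidity: all spikes are empty** — provided every letter is a letter of the relator
(which, in the application, contains every letter of the alphabet).  Hence every value of the
cyclically reduced binary product is a single letter of `r`: ZVC's *"n″ = n and the theorem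
follows"* in cyclic form. [cite: ZieschangVogtColdewey1980, Thm. 5.2.8] -/
theorem A_eq_nil (hsurj : ∀ x, ∃ k, C.ρ k = x) (k : ℕ) : C.A k = [] := by
  rw [C.A_eq_A_zero k]
  by_contra hne
  obtain ⟨L, Λ, hL⟩ := (eq_nil_or_concat (C.A 0)).resolve_left hne
  rw [concat_eq_append] at hL
  obtain ⟨p, hp⟩ := hsurj Λ
  have hr := C.isReduced p
  rw [C.A_eq_A_zero p, C.A_eq_A_zero (p + 1), hL, invRev_append_singleton, hp] at hr
  exact not_isReduced_append_cons_cons_inv (L ++ [Λ]) (FreeGroup.invRev L) Λ hr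

end SpikeConfig

end Literature.GroupTheory.CombinatorialGroupTheory
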